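import Literature.NumberTheory.ModularForms.PoincareSeriesWeightTwoRowClasses
import HarnessLib

/-!
# The weight-2 Hecke–Poincaré series of `Γ₀(N)` at the cusp `0`: the coset series of `Γ₀(N)S`
# (Iwaniec–Kowalski §14.1–§14.2 at `k = 2` with Hecke's factor; Iwaniec §2.4, §3.2)

Topic `Literature/NumberTheory/ModularForms` (namespace `Literature.NumberTheory.ModularForms.PoincareWeightTwo`,
continuing `PoincareSeriesWeightTwoHecke.lean`, `…HeckeConvergence.lean`, `…RowClasses.lean`).
Definitions with bodies (`cosetRow`, `cosetTerm`, `cosetP`, `cosetClassRow`, `cosetClassMap`) and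
THEOREMS; no named fact.

For `γ ∈ Γ₀(N)` with bottom row `v = (c,d)`, the matrix `γS` (`S = (0 −1; 1 0)`) has bottom row
`vS = (d, −c)`; the rows of the coset `Γ₀(N)S` are the coprime `(c', d')` with `N ∣ d'`. The series

  `cosetP N m s τ = ½ Σ_{v ∈ Row N} (dτ − c)⁻² |dτ − c|^{−2s} e(m (γ_v S) τ)`

is `P_m` read at the cusp `0`: **`P_m(Sτ, s) = τ² |τ|^{2s} · cosetP(τ, s)`** termwise
(`poincareHecke_S_smul`). It converges absolutely for `s > 0` (`summable_cosetTerm`, Eisenstein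
majorant), is even in the row, has period `N` in `Re τ` (`cosetTerm_translate`: the row `v(1 0; −N 1)`),
and its rows with `d > 0` are the classes `(N(d₀ + aℓ), a)`, `a ≥ 1`, `(a, N) = 1`, `d₀ ∈ (ℤ/aℤ)ˣ`,
`ℓ ∈ ℤ` (`cosetClassRow`, `cosetClassMap_injective`, `exists_cosetClassMap_eq_of_pos`,
`cosetTerm_cosetClassRow`: translating `ℓ` translates `τ` by `−Nℓ`), whence the regrouping
`tsum_row_eq_coset` of an absolutely summable even function of the rows along these classes.
These are the inputs of the Fourier expansion of `P_m` at the cusp `0` (stub T4a of the I1 skeleton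
`Summits/Parity/GeneralizedHardyLittlewood/Cruxes/PeterssonBoundPrinted/Lines/poincare_hecke.lean`:
uniform size of `yˢP_m(·,s)` near every cusp).

## References

* [IwaniecKowalski2004] H. Iwaniec, E. Kowalski, *Analytic Number Theory*, AMS Colloq. Publ. 53,
  §14.1 (14.4), §14.2 (proof of Lemma 14.2).
* [Iwaniec2002] H. Iwaniec, *Spectral Methods of Automorphic Forms*, §2.4 (double cosets of a cusp
  pair), §3.2.
-/

noncomputable section

open scoped MatrixGroups Real
open CongruenceSubgroup Complex
open UpperHalfPlane hiding I

namespace Literature.NumberTheory.ModularForms.PoincareWeightTwo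

variable {N : ℕ}

/-! ## Rows of the coset `Γ₀(N)S` and the coset series -/

/-- The bottom row `vS = (d, −c)` of `γ_v S` for a row `v = (c, d)`. [cite: Iwaniec2002, §2.4 (rows of a cusp pair)] -/
def cosetRow (v : Row N) : Fin 2 → ℤ := ![v.1 1, -(v.1 0)]

/-- `(cosetRow v) 0 = d`. [cite: Iwaniec2002, §2.4] -/
@[simp] theorem cosetRow_zero (v : Row N) : cosetRow v 0 = v.1 1 := rfl

/-- `(cosetRow v) 1 = −c`. [cite: Iwaniec2002, §2.4] -/
@[simp] theorem cosetRow_one (v : Row N) : cosetRow v 1 = -(v.1 0) := rfl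

/-- `(d, −c)` is coprime. [cite: Iwaniec2002, §2.4] -/
theorem isCoprime_cosetRow (v : Row N) : IsCoprime (cosetRow v 0) (cosetRow v 1) := by
  rw [cosetRow_zero, cosetRow_one]
  exact v.2.1.symm.neg_right

/-- The bottom row of `γ_v S` is `cosetRow v`. [cite: Iwaniec2002, §2.4] -/
theorem rowMatrix_mul_S_apply_one (v : Row N) :
    (rowMatrix v.1 v.2.1 * ModularGroup.S) 1 0 = cosetRow v 0 ∧
      (rowMatrix v.1 v.2.1 * ModularGroup.S) 1 1 = cosetRow v 1 := by
  constructor <;>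
  · rw [Matrix.SpecialLinearGroup.coe_mul, ModularGroup.coe_S, Matrix.mul_apply, Fin.sum_univ_two]
    simp

/-- One term of the coset series: `(dτ − c)⁻² |dτ − c|^{−2s} e(m (γ_v S) τ)`.
[cite: IwaniecKowalski2004, §14.1 (14.4) (at the cusp 0)] -/
def cosetTerm (N m : ℕ) (s : ℝ) (v : Row N) (τ : ℍ) : ℂ :=
  ((rowDenom (cosetRow v) τ) ^ 2)⁻¹ * ((‖rowDenom (cosetRow v) τ‖ ^ (-(2 * s)) : ℝ) : ℂ) *
    cexp (2 * π * I * m * (((rowMatrix v.1 v.2.1 * ModularGroup.S) • τ : ℍ) : ℂ))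

/-- **The coset series of `Γ₀(N)S`** (the weight-2 Hecke–Poincaré series read at the cusp `0`):
`cosetP N m s τ = ½ Σ_{v ∈ Row N} cosetTerm N m s v τ`. [cite: IwaniecKowalski2004, §14.1 (14.4) (at the cusp 0)] -/
def cosetP (N m : ℕ) (s : ℝ) (τ : ℍ) : ℂ :=
  (1 / 2 : ℂ) * ∑' v : Row N, cosetTerm N m s v τ

/-! ## `P_m(Sτ, s) = τ² |τ|^{2s} cosetP(τ, s)` -/

/-- `j_v(Sτ) = (dτ − c)/τ`. [cite: IwaniecKowalski2004, §14.1 (14.4)] -/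
theorem rowDenom_S_smul (v : Fin 2 → ℤ) (τ : ℍ) :
    rowDenom v (ModularGroup.S • τ) = ((v 1 : ℂ) * (τ : ℂ) + (-(v 0) : ℤ)) / (τ : ℂ) := by
  have hτ : (τ : ℂ) ≠ 0 := ne_zero τ
  rw [rowDenom, UpperHalfPlane.coe_specialLinearGroup_apply, ModularGroup.coe_S]
  simp
  field_simp
  ring

/-- **One term at `Sτ`**: `poincareTerm v (Sτ) = τ² |τ|^{2s} · cosetTerm v τ`.
[cite: IwaniecKowalski2004, §14.1 (14.4) (at the cusp 0)] -/
theorem poincareTerm_S_smul (m : ℕ) (s : ℝ) (v : Row N) (τ : ℍ) :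
    poincareTerm N m s v (ModularGroup.S • τ) =
      (τ : ℂ) ^ 2 * ((‖(τ : ℂ)‖ ^ (2 * s) : ℝ) : ℂ) * cosetTerm N m s v τ := by
  have hτ : (τ : ℂ) ≠ 0 := ne_zero τ
  have hX : rowDenom (cosetRow v) τ ≠ 0 := rowDenom_ne_zero _ (isCoprime_cosetRow v) τ
  have hrel : rowDenom v.1 (ModularGroup.S • τ) = rowDenom (cosetRow v) τ / (τ : ℂ) := by
    rw [rowDenom_S_smul, rowDenom, cosetRow_zero, cosetRow_one]
  have hτn : 0 < ‖(τ : ℂ)‖ := norm_pos_iff.mpr hτ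
  have hXn : 0 < ‖rowDenom (cosetRow v) τ‖ := norm_pos_iff.mpr hX
  unfold poincareTerm cosetTerm
  rw [hrel, mul_smul, norm_div, Real.div_rpow (norm_nonneg _) (norm_nonneg _),
    Real.rpow_neg hτn.le, Real.rpow_neg hXn.le, div_pow]
  have h1 : (((‖(τ : ℂ)‖ ^ (2 * s) : ℝ)) : ℂ) ≠ 0 := by exact_mod_cast (Real.rpow_pos_of_pos hτn _).ne'
  have h2 : (((‖rowDenom (cosetRow v) τ‖ ^ (2 * s) : ℝ)) : ℂ) ≠ 0 := by
    exact_mod_cast (Real.rpow_pos_of_pos hXn _).ne'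
  push_cast
  field_simp

/-- **`P_m(Sτ, s) = τ² |τ|^{2s} · cosetP(τ, s)`** (termwise; no convergence needed).
[cite: IwaniecKowalski2004, §14.1 (14.4) (at the cusp 0)] -/
theorem poincareHecke_S_smul (m : ℕ) (s : ℝ) (τ : ℍ) :
    poincareHecke N m s (ModularGroup.S • τ) =
      (τ : ℂ) ^ 2 * ((‖(τ : ℂ)‖ ^ (2 * s) : ℝ) : ℂ) * cosetP N m s τ := by
  unfold poincareHecke cosetP
  simp_rw [poincareTerm_S_smul m s _ τ]
  rw [tsum_mul_left]
  ring

/-! ## Size of a term and absolute convergence -/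

/-- `‖cosetTerm v τ‖ ≤ |dτ − c|^{−(2+2s)}`. [cite: IwaniecKowalski2004, §14.1 (14.4)] -/
theorem norm_cosetTerm_le (m : ℕ) (s : ℝ) (v : Row N) (τ : ℍ) :
    ‖cosetTerm N m s v τ‖ ≤ ‖rowDenom (cosetRow v) τ‖ ^ (-(2 + 2 * s)) := by
  have hj : 0 < ‖rowDenom (cosetRow v) τ‖ := norm_pos_iff.mpr (rowDenom_ne_zero _ (isCoprime_cosetRow v) τ)
  rw [cosetTerm, norm_mul, norm_mul, norm_inv, norm_pow, Complex.norm_real, Real.norm_eq_abs,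
    abs_of_nonneg (Real.rpow_nonneg hj.le _)]
  calc (‖rowDenom (cosetRow v) τ‖ ^ 2)⁻¹ * ‖rowDenom (cosetRow v) τ‖ ^ (-(2 * s)) *
        ‖cexp (2 * π * I * m * (((rowMatrix v.1 v.2.1 * ModularGroup.S) • τ : ℍ) : ℂ))‖
      ≤ (‖rowDenom (cosetRow v) τ‖ ^ 2)⁻¹ * ‖rowDenom (cosetRow v) τ‖ ^ (-(2 * s)) * 1 := by
        gcongr
        exact norm_cexp_two_pi_I_mul_le_one m _
    _ = ‖rowDenom (cosetRow v) τ‖ ^ (-(2 + 2 * s)) := by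
        rw [mul_one, ← Real.rpow_natCast, ← Real.rpow_neg hj.le, ← Real.rpow_add hj]
        congr 1
        push_cast
        ring

/-- `v ↦ cosetRow v` is injective. [cite: Iwaniec2002, §2.4] -/
theorem cosetRow_injective : Function.Injective (cosetRow (N := N)) := by
  intro v w h
  have h0 := congrFun h 0
  have h1 := congrFun h 1
  simp only [cosetRow_zero, cosetRow_one, neg_inj] at h0 h1
  apply Subtype.ext
  funext i
  fin_cases i
  · exact h1
  · exact h0

/-- **The Eisenstein majorant over the coset rows**: `Σ_v |dτ − c|^{−k} < ∞` for `k > 2` (the coset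
rows inject into `ℤ²`). [cite: IwaniecKowalski2004, §14.1 (absolute convergence for k > 2)] -/
theorem summable_norm_rowDenom_cosetRow_rpow {k : ℝ} (hk : 2 < k) (τ : ℍ) :
    Summable fun v : Row N ↦ ‖rowDenom (cosetRow v) τ‖ ^ (-k) := by
  have h1 : Summable fun x : Fin 2 → ℤ ↦ ‖(x 0 : ℂ) * (τ : ℂ) + x 1‖ ^ (-k) :=
    Summable.of_nonneg_of_le (fun x ↦ Real.rpow_nonneg (norm_nonneg _) _)
      (fun x ↦ EisensteinSeries.summand_bound τ (by linarith) x)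
      ((EisensteinSeries.summable_one_div_norm_rpow hk).mul_left _)
  exact h1.comp_injective cosetRow_injective

/-- **Absolute convergence of the coset series for `s > 0`.** [cite: IwaniecKowalski2004, §14.1 (14.4) with §3.2] -/
theorem summable_norm_cosetTerm (m : ℕ) {s : ℝ} (hs : 0 < s) (τ : ℍ) :
    Summable fun v : Row N ↦ ‖cosetTerm N m s v τ‖ :=
  (summable_norm_rowDenom_cosetRow_rpow (by linarith) τ).of_nonneg_of_le (fun _ ↦ norm_nonneg _)
    (fun v ↦ norm_cosetTerm_le m s v τ)

/-- `cosetP(τ, s)` is the sum of its series for `s > 0`. [cite: IwaniecKowalski2004, §14.1 (14.4)] -/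
theorem hasSum_cosetP (m : ℕ) {s : ℝ} (hs : 0 < s) (τ : ℍ) :
    HasSum (fun v : Row N ↦ (1 / 2 : ℂ) * cosetTerm N m s v τ) (cosetP N m s τ) := by
  unfold cosetP
  exact (summable_norm_cosetTerm m hs τ).of_norm.hasSum.mul_left _

/-! ## The Möbius action of a matrix with `c ≠ 0`; phases depend only on the row -/

/-- `g z = a/c − 1/(c(cz+d))` for `g = (a b; c d) ∈ SL(2, ℤ)`, `c ≠ 0`.
[cite: IwaniecKowalski2004, §14.2 (proof of Lemma 14.2)] -/
theorem coe_sl_smul_eq (g : SL(2, ℤ)) (hc : g 1 0 ≠ 0) (z : ℍ) :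
    ((g • z : ℍ) : ℂ) = ((g 0 0 : ℤ) : ℂ) / ((g 1 0 : ℤ) : ℂ) -
      1 / (((g 1 0 : ℤ) : ℂ) * rowDenom ((g : Matrix (Fin 2) (Fin 2) ℤ) 1) z) := by
  have hdet := g.det_coe
  rw [Matrix.det_fin_two] at hdet
  have hJ : rowDenom ((g : Matrix (Fin 2) (Fin 2) ℤ) 1) z ≠ 0 := by
    refine rowDenom_ne_zero _ ?_ z
    refine ⟨-(g 0 1), g 0 0, ?_⟩
    linear_combination hdet
  have hcC : ((g 1 0 : ℤ) : ℂ) ≠ 0 := by exact_mod_cast hc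
  set J : ℂ := rowDenom ((g : Matrix (Fin 2) (Fin 2) ℤ) 1) z with hJdef
  have hJe : ((g 1 0 : ℤ) : ℂ) * (z : ℂ) + ((g 1 1 : ℤ) : ℂ) = J := by rw [hJdef, rowDenom]
  have hcoe : ((g • z : ℍ) : ℂ) = (((g 0 0 : ℤ) : ℂ) * z + ((g 0 1 : ℤ) : ℂ)) / J := by
    rw [UpperHalfPlane.coe_specialLinearGroup_apply, ← hJe]
    simp
  have hdetC : ((g 0 0 : ℤ) : ℂ) * ((g 1 1 : ℤ) : ℂ) - ((g 0 1 : ℤ) : ℂ) * ((g 1 0 : ℤ) : ℂ) = 1 := by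
    exact_mod_cast hdet
  rw [hcoe, ← sub_eq_zero]
  have hfrac : (((g 0 0 : ℤ) : ℂ) * z + ((g 0 1 : ℤ) : ℂ)) / J -
      (((g 0 0 : ℤ) : ℂ) / ((g 1 0 : ℤ) : ℂ) - 1 / (((g 1 0 : ℤ) : ℂ) * J)) =
      ((((g 0 0 : ℤ) : ℂ) * z + ((g 0 1 : ℤ) : ℂ)) * ((g 1 0 : ℤ) : ℂ) -
        ((g 0 0 : ℤ) : ℂ) * J + 1) / (((g 1 0 : ℤ) : ℂ) * J) := by
    field_simp
    ring
  rw [hfrac, div_eq_zero_iff]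
  left
  rw [← hJe]
  linear_combination (-1 : ℂ) * hdetC

/-! ## Period `N`: the row action of `(1 0; −N 1) ∈ Γ₀(N)` -/

/-- The element `(1 0; −N 1)` of `Γ₀(N)` (it is `S T^{−N} S⁻¹`; right multiplication of the rows by it
realises the translation `τ ↦ τ + N` at the cusp `0`). [cite: Iwaniec2002, §2.4] -/
def lowerN (N : ℕ) : SL(2, ℤ) :=
  ⟨!![1, 0; -(N : ℤ), 1], by rw [Matrix.det_fin_two_of]; ring⟩

/-- `(1 0; −N 1) ∈ Γ₀(N)`. [cite: Iwaniec2002, §2.4] -/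
theorem lowerN_mem (N : ℕ) : lowerN N ∈ Gamma0 N := by
  rw [Gamma0_mem]
  simp [lowerN]

/-- The row `v (1 0; −N 1) = (c − Nd, d)`. [cite: Iwaniec2002, §2.4] -/
theorem rowSMul_lowerN_val (v : Row N) :
    (rowSMul (lowerN N) (lowerN_mem N) v).1 = ![v.1 0 - (N : ℤ) * v.1 1, v.1 1] := by
  rw [rowSMul_val]
  funext i
  fin_cases i
  · simp [lowerN, Matrix.vecMul, dotProduct, Fin.sum_univ_two]; ring
  · simp [lowerN, Matrix.vecMul, dotProduct, Fin.sum_univ_two]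

/-- **Translation by `N`**: the coset term of the row `v(1 0; −N 1)` at `τ` is the coset term of `v` at
`τ + N`. [cite: Iwaniec2002, §2.4] -/
theorem cosetTerm_rowSMul_lowerN (m : ℕ) (s : ℝ) (v : Row N) (τ : ℍ) :
    cosetTerm N m s (rowSMul (lowerN N) (lowerN_mem N) v) τ = cosetTerm N m s v (((N : ℝ) +ᵥ τ : ℍ)) := by
  have hden : rowDenom (cosetRow (rowSMul (lowerN N) (lowerN_mem N) v)) τ =
      rowDenom (cosetRow v) (((N : ℝ) +ᵥ τ : ℍ)) := by
    simp only [rowDenom, cosetRow, rowSMul_lowerN_val, UpperHalfPlane.coe_vadd, Matrix.cons_val_zero,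
      Matrix.cons_val_one]
    push_cast
    ring
  unfold cosetTerm
  rw [hden]
  congr 1
  have h := cexp_smul_eq_of_row_eq m
    (rowMatrix (rowSMul (lowerN N) (lowerN_mem N) v).1 (rowSMul (lowerN N) (lowerN_mem N) v).2.1 *
      ModularGroup.S)
    (rowMatrix v.1 v.2.1 * ModularGroup.S * ModularGroup.T ^ (N : ℤ)) ?_ ?_ τ
  · rw [h, mul_smul, UpperHalfPlane.modular_T_zpow_smul]
    push_cast
    ring_nf
  · rw [(rowMatrix_mul_S_apply_one _).1, Matrix.SpecialLinearGroup.coe_mul, Matrix.mul_apply,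
      Fin.sum_univ_two, (rowMatrix_mul_S_apply_one _).1, (rowMatrix_mul_S_apply_one _).2,
      ModularGroup.coe_T_zpow]
    simp [cosetRow, rowSMul_lowerN_val]
  · rw [(rowMatrix_mul_S_apply_one _).2, Matrix.SpecialLinearGroup.coe_mul, Matrix.mul_apply,
      Fin.sum_univ_two, (rowMatrix_mul_S_apply_one _).1, (rowMatrix_mul_S_apply_one _).2,
      ModularGroup.coe_T_zpow]
    simp [cosetRow, rowSMul_lowerN_val]
    ring

/-- **The coset series has period `N`**: `cosetP(τ + N, s) = cosetP(τ, s)` (reindex the rows by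
`v ↦ v(1 0; −N 1)`). [cite: Iwaniec2002, §2.4] -/
theorem cosetP_vadd (m : ℕ) (s : ℝ) (τ : ℍ) :
    cosetP N m s (((N : ℝ) +ᵥ τ : ℍ)) = cosetP N m s τ := by
  unfold cosetP
  congr 1
  have h := (rowSMulEquiv (lowerN N) (lowerN_mem N)).tsum_eq (fun v ↦ cosetTerm N m s v τ)
  simp only [rowSMulEquiv, Equiv.coe_fn_mk] at h
  rw [← h]
  simp_rw [cosetTerm_rowSMul_lowerN]

/-! ## Negation, translation by `N`, and the classes of the coset rows -/

/-- `cosetRow (−v) = −cosetRow v`. [cite: Iwaniec2002, §2.4] -/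
theorem cosetRow_negRow (v : Row N) : cosetRow (negRow v) = -cosetRow v := by
  funext i; fin_cases i <;> simp [cosetRow]

/-- The coset term is even in the row. [cite: IwaniecKowalski2004, §14.1 (14.4)] -/
theorem cosetTerm_negRow (m : ℕ) (s : ℝ) (v : Row N) (τ : ℍ) :
    cosetTerm N m s (negRow v) τ = cosetTerm N m s v τ := by
  unfold cosetTerm
  have hden : rowDenom (cosetRow (negRow v)) τ = -rowDenom (cosetRow v) τ := by
    rw [cosetRow_negRow, rowDenom, rowDenom]; simp; ring
  rw [hden, neg_sq, norm_neg]
  congr 1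
  have h := cexp_smul_eq_of_row_eq m (rowMatrix (negRow v).1 (negRow v).2.1 * ModularGroup.S)
    (-(rowMatrix v.1 v.2.1 * ModularGroup.S)) ?_ ?_ τ
  · rw [h, ModularGroup.SL_neg_smul]
  · rw [(rowMatrix_mul_S_apply_one (negRow v)).1]
    simp [Matrix.mul_apply, Fin.sum_univ_two, ModularGroup.coe_S, cosetRow]
  · rw [(rowMatrix_mul_S_apply_one (negRow v)).2]
    simp [Matrix.mul_apply, Fin.sum_univ_two, ModularGroup.coe_S, cosetRow]

section Classes

variable (N) [NeZero N]

/-- The row `(N(d₀ + aℓ), a)` of `Γ₀(N)` whose coset row is `(a, −N(d₀ + aℓ))`: `a ≥ 1` with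
`(a, N) = 1`, `d₀` the least residue of the unit `u` mod `a`, `ℓ ∈ ℤ`.
[cite: Iwaniec2002, §2.4 (double cosets of the cusp pair (∞, 0))] -/
def cosetClassRow (a : {r : ℕ // Nat.Coprime (r + 1) N}) (u : (ZMod (a.1 + 1))ˣ) (ℓ : ℤ) : Row N :=
  ⟨![(N : ℤ) * (((u : ZMod (a.1 + 1)).val : ℤ) + ((a.1 + 1 : ℕ) : ℤ) * ℓ), ((a.1 + 1 : ℕ) : ℤ)], by
    constructor
    · simp only [Matrix.cons_val_zero, Matrix.cons_val_one]
      have hNa : IsCoprime (N : ℤ) ((a.1 + 1 : ℕ) : ℤ) := by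
        rw [Int.isCoprime_iff_gcd_eq_one, Int.gcd_natCast_natCast]
        exact a.2.symm
      have hua : IsCoprime (((u : ZMod (a.1 + 1)).val : ℤ) + ((a.1 + 1 : ℕ) : ℤ) * ℓ) ((a.1 + 1 : ℕ) : ℤ) := by
        have h0 : IsCoprime (((u : ZMod (a.1 + 1)).val : ℤ)) ((a.1 + 1 : ℕ) : ℤ) := by
          rw [Int.isCoprime_iff_gcd_eq_one, Int.gcd_natCast_natCast]
          exact ZMod.val_coe_unit_coprime u
        have := (h0.symm.add_mul_left_right ℓ).symm
        simpa [mul_comm] using this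
      exact hNa.mul_left hua
    · simp only [Matrix.cons_val_zero]
      exact dvd_mul_right _ _⟩

variable {N}

omit [NeZero N] in
/-- The `c`-component of `cosetClassRow`. [cite: Iwaniec2002, §2.4] -/
@[simp] theorem cosetClassRow_apply_zero (a : {r : ℕ // Nat.Coprime (r + 1) N}) (u : (ZMod (a.1 + 1))ˣ)
    (ℓ : ℤ) : (cosetClassRow N a u ℓ).1 0 =
      (N : ℤ) * (((u : ZMod (a.1 + 1)).val : ℤ) + ((a.1 + 1 : ℕ) : ℤ) * ℓ) := rfl

omit [NeZero N] in
/-- The `d`-component of `cosetClassRow`. [cite: Iwaniec2002, §2.4] -/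
@[simp] theorem cosetClassRow_apply_one (a : {r : ℕ // Nat.Coprime (r + 1) N}) (u : (ZMod (a.1 + 1))ˣ)
    (ℓ : ℤ) : (cosetClassRow N a u ℓ).1 1 = ((a.1 + 1 : ℕ) : ℤ) := rfl

omit [NeZero N] in
/-- `0 < d` on a coset class row. [cite: Iwaniec2002, §2.4] -/
theorem cosetClassRow_apply_one_pos (a : {r : ℕ // Nat.Coprime (r + 1) N}) (u : (ZMod (a.1 + 1))ˣ)
    (ℓ : ℤ) : 0 < (cosetClassRow N a u ℓ).1 1 := by
  rw [cosetClassRow_apply_one]; exact_mod_cast Nat.succ_pos a.1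

omit [NeZero N] in
/-- `j_{coset}(τ)` of the class row `ℓ` is `j_{coset}` of the class row `0` at `τ − Nℓ`:
`aτ − N(d₀ + aℓ) = a(τ − Nℓ) − Nd₀`. [cite: Iwaniec2002, §2.4] -/
theorem rowDenom_cosetClassRow (a : {r : ℕ // Nat.Coprime (r + 1) N}) (u : (ZMod (a.1 + 1))ˣ)
    (ℓ : ℤ) (τ : ℍ) :
    rowDenom (cosetRow (cosetClassRow N a u ℓ)) τ =
      rowDenom (cosetRow (cosetClassRow N a u 0)) (((-((N : ℝ) * ℓ)) +ᵥ τ : ℍ)) := by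
  simp only [rowDenom, cosetRow_zero, cosetRow_one, cosetClassRow_apply_zero, cosetClassRow_apply_one,
    UpperHalfPlane.coe_vadd]
  push_cast
  ring

omit [NeZero N] in
/-- **Translating `ℓ` translates `τ` by `−Nℓ`** on the coset terms (the rows `γ_{v_ℓ}S` and
`γ_{v_0}S T^{−Nℓ}` coincide). [cite: Iwaniec2002, §2.4] -/
theorem cosetTerm_cosetClassRow (m : ℕ) (s : ℝ) (a : {r : ℕ // Nat.Coprime (r + 1) N})
    (u : (ZMod (a.1 + 1))ˣ) (ℓ : ℤ) (τ : ℍ) :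
    cosetTerm N m s (cosetClassRow N a u ℓ) τ =
      cosetTerm N m s (cosetClassRow N a u 0) (((-((N : ℝ) * ℓ)) +ᵥ τ : ℍ)) := by
  unfold cosetTerm
  rw [rowDenom_cosetClassRow]
  congr 1
  have h := cexp_smul_eq_of_row_eq m
    (rowMatrix (cosetClassRow N a u ℓ).1 (cosetClassRow N a u ℓ).2.1 * ModularGroup.S)
    (rowMatrix (cosetClassRow N a u 0).1 (cosetClassRow N a u 0).2.1 * ModularGroup.S *
      ModularGroup.T ^ (-((N : ℤ) * ℓ))) ?_ ?_ τ
  · rw [h, mul_smul, UpperHalfPlane.modular_T_zpow_smul]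
    push_cast
    ring_nf
  · rw [(rowMatrix_mul_S_apply_one _).1, Matrix.SpecialLinearGroup.coe_mul, Matrix.mul_apply,
      Fin.sum_univ_two, (rowMatrix_mul_S_apply_one _).1, (rowMatrix_mul_S_apply_one _).2,
      ModularGroup.coe_T_zpow]
    simp
  · rw [(rowMatrix_mul_S_apply_one _).2, Matrix.SpecialLinearGroup.coe_mul, Matrix.mul_apply,
      Fin.sum_univ_two, (rowMatrix_mul_S_apply_one _).1, (rowMatrix_mul_S_apply_one _).2,
      ModularGroup.coe_T_zpow]
    simp
    ring

/-- The index map of the coset rows with `d > 0`: `(a, u, ℓ) ↦ (N(d₀(u) + aℓ), a)`.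
[cite: Iwaniec2002, §2.4] -/
def cosetClassMap (N : ℕ) (x : Σ a : {r : ℕ // Nat.Coprime (r + 1) N}, (ZMod (a.1 + 1))ˣ × ℤ) : Row N :=
  cosetClassRow N x.1 x.2.1 x.2.2

omit [NeZero N] in
/-- **`(a, u, ℓ) ↦ (N(d₀ + aℓ), a)` is injective.** [cite: Iwaniec2002, §2.4] -/
theorem cosetClassMap_injective (N : ℕ) [NeZero N] : Function.Injective (cosetClassMap N) := by
  rintro ⟨a, u, ℓ⟩ ⟨a', u', ℓ'⟩ h
  have h0 := congrArg (fun v : Row N ↦ v.1 0) h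
  have h1 := congrArg (fun v : Row N ↦ v.1 1) h
  simp only [cosetClassMap, cosetClassRow_apply_zero, cosetClassRow_apply_one] at h0 h1
  have ha : a = a' := Subtype.ext (by
    have : a.1 + 1 = a'.1 + 1 := by exact_mod_cast h1
    omega)
  subst ha
  have hN : (N : ℤ) ≠ 0 := by exact_mod_cast NeZero.ne N
  have h0' := mul_left_cancel₀ hN h0
  have hc : (0 : ℤ) < ((a.1 + 1 : ℕ) : ℤ) := by exact_mod_cast Nat.succ_pos a.1
  have hmod := congrArg (fun t : ℤ ↦ t % ((a.1 + 1 : ℕ) : ℤ)) h0'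
  simp only [Int.add_mul_emod_self_left] at hmod
  have hv : ((u : ZMod (a.1 + 1)).val : ℤ) % ((a.1 + 1 : ℕ) : ℤ) = ((u : ZMod (a.1 + 1)).val : ℤ) :=
    Int.emod_eq_of_lt (by positivity) (by exact_mod_cast ZMod.val_lt _)
  have hv' : ((u' : ZMod (a.1 + 1)).val : ℤ) % ((a.1 + 1 : ℕ) : ℤ) = ((u' : ZMod (a.1 + 1)).val : ℤ) :=
    Int.emod_eq_of_lt (by positivity) (by exact_mod_cast ZMod.val_lt _)
  rw [hv, hv'] at hmod
  have hu : u = u' := by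
    apply Units.ext
    have : (u : ZMod (a.1 + 1)).val = (u' : ZMod (a.1 + 1)).val := by exact_mod_cast hmod
    exact ZMod.val_injective _ this
  subst hu
  have hℓ : ℓ = ℓ' := by
    have := h0'
    rw [add_right_inj] at this
    exact mul_left_cancel₀ hc.ne' this
  subst hℓ
  rfl

omit [NeZero N] in
/-- **Every row `(c, d)` of `Γ₀(N)` with `d > 0` is a coset class row**: `(d, N) = 1`, `c = Nc₁`,
`c₁ = d₀ + dℓ` with `d₀ = c₁ mod d` a unit. [cite: Iwaniec2002, §2.4] -/
theorem exists_cosetClassMap_eq_of_pos [NeZero N] (v : Row N) (hv : 0 < v.1 1) :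
    ∃ x, cosetClassMap N x = v := by
  obtain ⟨c₁, hc₁⟩ := v.2.2
  obtain ⟨r, hr⟩ : ∃ r : ℕ, ((r + 1 : ℕ) : ℤ) = v.1 1 := ⟨(v.1 1 - 1).toNat, by push_cast; omega⟩
  -- `(d, N) = 1` and `(c₁, d) = 1`
  have hcop : IsCoprime (v.1 0) (v.1 1) := v.2.1
  rw [hc₁] at hcop
  have hNd : IsCoprime (N : ℤ) (v.1 1) := hcop.of_mul_left_left
  have hc₁d : IsCoprime c₁ (v.1 1) := hcop.of_mul_left_right
  have haN : Nat.Coprime (r + 1) N := by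
    rw [← hr] at hNd
    have := Int.isCoprime_iff_gcd_eq_one.mp hNd
    rw [Int.gcd_natCast_natCast] at this
    exact Nat.Coprime.symm this
  let A : {r : ℕ // Nat.Coprime (r + 1) N} := ⟨r, haN⟩
  have hc₁a : IsCoprime c₁ (((A.1 + 1 : ℕ)) : ℤ) := by rwa [show ((A.1 + 1 : ℕ) : ℤ) = v.1 1 from hr]
  set u : (ZMod (A.1 + 1))ˣ := ZMod.unitOfIsCoprime c₁ hc₁a with hu
  have hval : ((u : ZMod (A.1 + 1)).val : ℤ) = c₁ % ((A.1 + 1 : ℕ) : ℤ) := by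
    rw [hu, ZMod.coe_unitOfIsCoprime, ZMod.val_intCast]
  refine ⟨⟨A, u, c₁ / ((A.1 + 1 : ℕ) : ℤ)⟩, ?_⟩
  apply Subtype.ext
  funext i
  fin_cases i
  · show (N : ℤ) * (((u : ZMod (A.1 + 1)).val : ℤ) + ((A.1 + 1 : ℕ) : ℤ) * (c₁ / ((A.1 + 1 : ℕ) : ℤ))) = v.1 0
    rw [hval, Int.emod_add_mul_ediv, hc₁]
  · show ((A.1 + 1 : ℕ) : ℤ) = v.1 1
    exact hr

end Classes

/-! ## Regrouping an absolutely convergent sum over the coset rows -/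

/-- There is no row of `Γ₀(N)` with `d = 0` when `N ≥ 2` (`(c, 0)` coprime forces `c = ±1`, but `N ∣ c`).
[cite: Iwaniec2002, §2.4 (no diagonal term for the cusp pair (∞, 0))] -/
theorem row_apply_one_ne_zero (hN : 2 ≤ N) (v : Row N) : v.1 1 ≠ 0 := by
  intro h
  have hcop := v.2.1
  rw [h, isCoprime_zero_right, Int.isUnit_iff] at hcop
  have hdvd : (N : ℤ) ∣ v.1 0 := v.2.2
  have h1 : (N : ℤ) ∣ 1 := by
    rcases hcop with h1 | h1
    · rwa [h1] at hdvd
    · rw [h1] at hdvd; exact (dvd_neg.mp hdvd)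
  have hN1 : (N : ℤ) ≤ 1 := Int.le_of_dvd one_pos h1
  omega

/-- **Regrouping the coset rows** (`N ≥ 2`): for an absolutely summable, even function `f` on the rows
of `Γ₀(N)`, `Σ_v f(v) = 2 Σ_{a ≥ 1, (a,N)=1} Σ_{u ∈ (ℤ/aℤ)ˣ} Σ_{ℓ∈ℤ} f(N(d₀(u) + aℓ), a)` (no rows
with `d = 0`; `d < 0` doubles `d > 0`; `c = N(d₀ + dℓ)`). [cite: Iwaniec2002, §2.4 (double cosets of the cusp pair (∞, 0))] -/
theorem tsum_row_eq_coset [NeZero N] (hN : 2 ≤ N) {f : Row N → ℂ} (hf : Summable fun v ↦ ‖f v‖)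
    (hneg : ∀ v, f (negRow v) = f v) :
    ∑' v, f v = 2 * ∑' a : {r : ℕ // Nat.Coprime (r + 1) N}, ∑ u : (ZMod (a.1 + 1))ˣ, ∑' ℓ : ℤ,
      f (cosetClassRow N a u ℓ) := by
  classical
  set fp : Row N → ℂ := fun v ↦ if 0 < v.1 1 then f v else 0 with hfp
  set fn : Row N → ℂ := fun v ↦ if v.1 1 < 0 then f v else 0 with hfn
  have hsplit : ∀ v, f v = fp v + fn v := by
    intro v
    simp only [hfp, hfn]
    rcases lt_trichotomy (v.1 1) 0 with h | h | h
    · rw [if_neg (not_lt.mpr h.le), if_pos h]; ring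
    · exact absurd h (row_apply_one_ne_zero hN v)
    · rw [if_pos h, if_neg (not_lt.mpr h.le)]; ring
  have hbd : ∀ (p : Row N → Prop) [DecidablePred p],
      Summable fun v ↦ (if p v then f v else 0 : ℂ) := by
    intro p _
    refine Summable.of_norm_bounded hf fun v ↦ ?_
    split_ifs <;> simp
  have hps : Summable fp := hbd _
  have hns : Summable fn := hbd _
  have htot : ∑' v, f v = ∑' v, fp v + ∑' v, fn v := by
    rw [show (fun v ↦ f v) = fun v ↦ fp v + fn v from funext hsplit, hps.tsum_add hns]
  have hn : ∑' v, fn v = ∑' v, fp v := by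
    rw [← negRowEquiv.tsum_eq fp]
    refine tsum_congr fun v ↦ ?_
    simp only [hfn, hfp, negRowEquiv_apply, negRow_val, Pi.neg_apply, neg_pos, hneg]
  have hsupp : Function.support fp ⊆ Set.range (cosetClassMap N) := by
    intro v hv
    rw [Function.mem_support] at hv
    have hpos : 0 < v.1 1 := by
      by_contra h
      exact hv (by simp only [hfp]; rw [if_neg h])
    exact exists_cosetClassMap_eq_of_pos v hpos
  have hinj := cosetClassMap_injective N
  have hp : ∑' v, fp v = ∑' a : {r : ℕ // Nat.Coprime (r + 1) N}, ∑ u : (ZMod (a.1 + 1))ˣ, ∑' ℓ : ℤ,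
      f (cosetClassRow N a u ℓ) := by
    rw [← hinj.tsum_eq hsupp]
    have hcomp : ∀ x, fp (cosetClassMap N x) = f (cosetClassMap N x) := fun x ↦ by
      simp only [hfp]
      rw [if_pos]
      exact cosetClassRow_apply_one_pos _ _ _
    simp_rw [hcomp]
    have hS : Summable fun x ↦ f (cosetClassMap N x) := hf.of_norm.comp_injective hinj
    rw [hS.tsum_sigma]
    refine tsum_congr fun a ↦ ?_
    rw [(hS.sigma_factor a).tsum_prod, tsum_fintype]
    rfl
  rw [htot, hn, hp]
  ring

end Literature.NumberTheory.ModularForms.PoincareWeightTwo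

end
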